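import Mathlib
import Literature.NumberTheory.Automorphic.GaloisActionPlaces
import Literature.NumberTheory.GaloisRepresentations.FrobeniusDensityTheorem
import Literature.NumberTheory.QuadraticForms.HilbertReciprocityFiniteness
import Summits.Langlands.Langlands.Theorems.PicardMuOrdinaryResidualAutomorphyEvenHypotheses
import Summits.Langlands.Langlands.Theorems.PicardMuOrdinaryResidualAutomorphyEvenFrobTable
import Summits.Langlands.Langlands.Theorems.PicardMuOrdinaryResidualAutomorphyEvenEpsilon

/-!
# The Galois side of `ResidualAutomorphyEven`: the branch-point table is the induced Euler factor of a
# quadratic Hecke character of the cubic resolvent field (milestone, unconditional)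

Helper file for item stmt-Langlands-13760 (route `PicardMuOrdinary`).  For an integer quartic `f` with
four real roots, separable, with `12 ∣ #Gal(f)`, let `K = ℚ(ω)`, `M` the splitting field of `f ⊗ K`,
`E ⊆ M` the cubic resolvent field over `K` (`Tower` file) and `ε = ω_{E(√δ)/E}` the quadratic Hecke
character of `E` of the `Epsilon` file.  **Main theorem** (`eventually_finprod_eq_table`): for all but
finitely many finite places `v` of `K`,

  `∏_{w ∣ v} (X^{f(w|v)} - ε(ϖ_w)) = T(f, v)`  in `ℂ[X]`,

where `T(f, v) ∈ ℤ[X]` is the five-way branch-point table of the route decl (number of roots of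
`f mod v`, square class of its discriminant).  This is the local content of the item: granted automorphic
induction from `GL₁/E` to `GL₃/K` (Jacquet–Piatetski-Shapiro–Shalika), the Satake polynomials of
`AI(ε)` are the left-hand side.  The proof assembles `finprod_placesOver_eq_inducedPoly` (places of `E`
above `v` ↔ Frobenius orbits on the pairings, `ε(ϖ_w)` = block sign) with `inducedPoly_perm4_eq_table`
(Dedekind, Stickelberger) at a prime `W ∣ v` of `𝓞 M` and an arithmetic Frobenius `g`, after discarding
the finitely many `v` that ramify in `M` or lie below a prime of `𝓞 M` containing `2`, `a₄`, a difference
of integral roots, or a conjugate of `s = √δ`.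
-/

set_option linter.dupNamespace false -- project-wide option (lakefile weak.linter.dupNamespace); `Summit.Langlands.Langlands` is the mandated namespace

noncomputable section

namespace Summit.Langlands.Langlands.Theorems.ResidualAutomorphyEven

open Polynomial Equiv Finset NumberField Pairing IsDedekindDomain Filter
open Literature.NumberTheory.GaloisRepresentations Literature.NumberTheory.Automorphic
  Literature.NumberTheory.QuadraticForms
open scoped Classical Pointwise

variable {f : ℤ[X]}

/-! ### Finiteness of the bad places -/

/-- The places of `K` lying below a prime of `𝓞 M` that contains `x`. -/
def badBelow (x : 𝓞 (M f)) : Set (HeightOneSpectrum (𝓞 K)) :=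
  (fun W : HeightOneSpectrum (𝓞 (M f)) => W.under (𝓞 K)) '' {W | x ∈ W.asIdeal}

/-- For `x ≠ 0` only finitely many places of `K` lie below a prime containing `x`. -/
theorem finite_badBelow {x : 𝓞 (M f)} (hx : x ≠ 0) : (badBelow x).Finite :=
  (finite_setOf_mem_asIdeal (M f) hx).image _

/-- Off `badBelow x`, no prime of `𝓞 M` above `v` contains `x`. -/
theorem not_mem_of_not_mem_badBelow {x : 𝓞 (M f)} {v : HeightOneSpectrum (𝓞 K)} (hv : v ∉ badBelow x)
    (W : Ideal (𝓞 (M f))) [W.IsMaximal] (hW : v.asIdeal = W.under (𝓞 K)) : x ∉ W := fun hxW =>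
  hv ⟨placeW W, hxW, HeightOneSpectrum.ext (by rw [HeightOneSpectrum.under_asIdeal]; exact hW.symm)⟩

/-- **The exceptional set**: places of `K` ramified in `M`, or below a prime of `𝓞 M` containing `2`,
`a₄`, some `xᵢ - xⱼ` (`i ≠ j`) or some conjugate `τ s` of `s`. -/
def badSet (h : IsSepQuartic f) : Set (HeightOneSpectrum (𝓞 K)) :=
  {v | ¬ Algebra.IsUnramifiedIn (𝓞 (M f)) v.asIdeal} ∪ badBelow (2 : 𝓞 (M f)) ∪ badBelow (lcInt f) ∪
    (⋃ ij : Fin 4 × Fin 4, if ij.1 = ij.2 then ∅ else badBelow (xInt h ij.1 - xInt h ij.2)) ∪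
    ⋃ τ : G f, badBelow (τ • sInt h)

/-- `a₄ ≠ 0` in `𝓞 M`. -/
theorem lcInt_ne_zero (hlc : f.leadingCoeff ≠ 0) : lcInt f ≠ 0 := by
  intro h0
  apply lc_ne_zero (f := f) hlc
  rw [← coe_lcInt, h0]; rfl

/-- `s ≠ 0` in `𝓞 M`. -/
theorem sInt_ne_zero (h : IsSepQuartic f) (h12 : 12 ∣ Nat.card (G f)) (hlc : f.leadingCoeff ≠ 0) : sInt h ≠ 0 := by
  intro h0
  apply sElt_ne_zero h h12 hlc
  rw [← coe_sInt, h0]; rfl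

/-- **The exceptional set is finite.** -/
theorem finite_badSet (h : IsSepQuartic f) (h12 : 12 ∣ Nat.card (G f)) (hlc : f.leadingCoeff ≠ 0) :
    (badSet h).Finite := by
  refine (((Set.Finite.union ?_ ?_).union ?_).union ?_).union ?_
  · exact finite_setOf_not_isUnramifiedIn K (M f)
  · exact finite_badBelow two_ne_zero
  · exact finite_badBelow (lcInt_ne_zero hlc)
  · refine Set.finite_iUnion fun ij => ?_
    split_ifs with hij
    · exact Set.finite_empty
    · exact finite_badBelow (sub_ne_zero.mpr fun heq => hij (xInt_injective h hlc heq))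
  · haveI : Finite (G f) := inferInstance
    exact Set.finite_iUnion fun τ => finite_badBelow ((smul_ne_zero_iff_ne τ).mpr (sInt_ne_zero h h12 hlc))

/-! ### The milestone -/

/-- **What goodness buys at any prime `W ∣ v` of `𝓞 M`**: `v` unramified in `M`, `2 ∉ W`, `a₄ ∉ W`,
`xᵢ - xⱼ ∉ W` (`i ≠ j`), `τ s ∉ W` for all `τ ∈ G`. -/
theorem good_of_not_mem_badSet (h : IsSepQuartic f) {v : HeightOneSpectrum (𝓞 K)} (hv : v ∉ badSet h)
    (W : Ideal (𝓞 (M f))) [W.IsMaximal] (hvW : v.asIdeal = W.under (𝓞 K)) :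
    Algebra.IsUnramifiedIn (𝓞 (M f)) v.asIdeal ∧ (2 : 𝓞 (M f)) ∉ W ∧ abar W ≠ 0 ∧
      (∀ i j, i ≠ j → xInt h i - xInt h j ∉ W) ∧ ∀ τ : G f, τ • sInt h ∉ W := by
  simp only [badSet, Set.mem_union, Set.mem_setOf_eq, Set.mem_iUnion, not_or, not_exists, not_not] at hv
  obtain ⟨⟨⟨⟨hunr, h2⟩, ha⟩, hx⟩, hs⟩ := hv
  refine ⟨hunr, not_mem_of_not_mem_badBelow h2 W hvW,
    fun h0 => not_mem_of_not_mem_badBelow ha W hvW (Ideal.Quotient.eq_zero_iff_mem.mp h0),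
    fun i j hij => ?_, fun τ => not_mem_of_not_mem_badBelow (hs τ) W hvW⟩
  have hij' := hx (i, j)
  rw [if_neg hij] at hij'
  exact not_mem_of_not_mem_badBelow hij' W hvW

/-- **At a good place the branch-point table is the induced Euler factor of `ε`**, computed at any prime
`W ∣ v` of `𝓞 M` with any arithmetic Frobenius `g`. -/
theorem finprod_eq_table_of_isArithFrobAt (h : IsSepQuartic f) (h12 : 12 ∣ Nat.card (G f))
    (hlc : f.leadingCoeff ≠ 0) {v : HeightOneSpectrum (𝓞 K)} (hv : v ∉ badSet h)
    (W : Ideal (𝓞 (M f))) [W.IsMaximal] (hvW : v.asIdeal = W.under (𝓞 K)) {g : G f}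
    (hg : IsArithFrobAt (𝓞 K) g W) :
    ∏ᶠ w ∈ {w : HeightOneSpectrum (𝓞 (E h)) | w.under (𝓞 K) = v},
        (X ^ w.asIdeal.inertiaDeg (𝓞 K) - C ((eps h h12 hlc).valueAtUniformizer w)) =
      (if (fbar f v).roots.toFinset.card = 4 then (X - 1) ^ 3
        else if (fbar f v).roots.toFinset.card = 2 then (X - 1) ^ 2 * (X + 1)
        else if (fbar f v).roots.toFinset.card = 1 then X ^ 3 - 1
        else if (∃ y : 𝓞 K ⧸ v.asIdeal, y ^ 2 = (fbar f v).discr) then (X - 1) * (X + 1) ^ 2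
        else X ^ 3 + X ^ 2 + X + 1 : ℤ[X]).map (Int.castRingHom ℂ) := by
  have hG := isGalois_M h
  obtain ⟨hunr, h2W, haW, hxW, hsW⟩ := good_of_not_mem_badSet h hv W hvW
  rw [finprod_placesOver_eq_inducedPoly h h12 W v hvW hG hunr hlc hg h2W hsW,
    inducedPoly_perm4_eq_table h W v hvW hg hxW haW h2W]

/-- **At a good place the branch-point table is the induced Euler factor of `ε`** (one `v`). -/
theorem finprod_eq_table_of_not_mem_badSet (h : IsSepQuartic f) (h12 : 12 ∣ Nat.card (G f))
    (hlc : f.leadingCoeff ≠ 0) {v : HeightOneSpectrum (𝓞 K)} (hv : v ∉ badSet h) :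
    ∏ᶠ w ∈ {w : HeightOneSpectrum (𝓞 (E h)) | w.under (𝓞 K) = v},
        (X ^ w.asIdeal.inertiaDeg (𝓞 K) - C ((eps h h12 hlc).valueAtUniformizer w)) =
      (if (fbar f v).roots.toFinset.card = 4 then (X - 1) ^ 3
        else if (fbar f v).roots.toFinset.card = 2 then (X - 1) ^ 2 * (X + 1)
        else if (fbar f v).roots.toFinset.card = 1 then X ^ 3 - 1
        else if (∃ y : 𝓞 K ⧸ v.asIdeal, y ^ 2 = (fbar f v).discr) then (X - 1) * (X + 1) ^ 2
        else X ^ 3 + X ^ 2 + X + 1 : ℤ[X]).map (Int.castRingHom ℂ) := by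
  -- a prime `W ∣ v` of `𝓞 M` and an arithmetic Frobenius `g` at `W`
  haveI := v.isMaximal
  obtain ⟨W, hWmax, hWover⟩ := Ideal.exists_maximal_ideal_liesOver_of_isIntegral (S := 𝓞 (M f)) v.asIdeal
  haveI := hWmax
  haveI := isGalois_M h
  obtain ⟨g, hg⟩ := exists_isArithFrobAt_ringOfIntegers (M := K) W (W_ne_bot W)
  exact finprod_eq_table_of_isArithFrobAt h h12 hlc hv W hWover.over hg

/-- **Milestone (unconditional Galois side of `ResidualAutomorphyEven`).**  For `f ∈ ℤ[X]` of degree `4`,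
separable over `ℚ`, with `12 ∣ #Gal(f)` and four real roots, the quadratic Hecke character
`ε = eps h h12 hlc` of the cubic resolvent field `E ⊇ K = ℚ(ω)` has finite order and, for all but
finitely many finite places `v` of `K`, its induced Euler factor `∏_{w ∣ v} (X^{f(w|v)} - ε(ϖ_w))` along
`E/K` is the route's branch-point table at `v` (read in `ℂ[X]`). -/
theorem eventually_finprod_eq_table (f : ℤ[X]) (hdeg : f.natDegree = 4)
    (hsep : (f.map (Int.castRingHom ℚ)).Separable) (hgal : 12 ∣ Nat.card (f.map (Int.castRingHom ℚ)).Gal)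
    (hreal : (f.map (Int.castRingHom ℝ)).roots.card = 4) :
    (eps (isSepQuartic_of_hyp hdeg hsep) (twelve_dvd_card_G_of_hyp hdeg hsep hgal hreal)
        (leadingCoeff_ne_zero_of_hyp hdeg)).IsFiniteOrder ∧
    ∀ᶠ v : HeightOneSpectrum (𝓞 K) in cofinite,
      ∏ᶠ w ∈ {w : HeightOneSpectrum (𝓞 (E (isSepQuartic_of_hyp hdeg hsep))) | w.under (𝓞 K) = v},
          (X ^ w.asIdeal.inertiaDeg (𝓞 K) -
            C ((eps (isSepQuartic_of_hyp hdeg hsep) (twelve_dvd_card_G_of_hyp hdeg hsep hgal hreal)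
              (leadingCoeff_ne_zero_of_hyp hdeg)).valueAtUniformizer w)) =
        (if (fbar f v).roots.toFinset.card = 4 then (X - 1) ^ 3
          else if (fbar f v).roots.toFinset.card = 2 then (X - 1) ^ 2 * (X + 1)
          else if (fbar f v).roots.toFinset.card = 1 then X ^ 3 - 1
          else if (∃ y : 𝓞 K ⧸ v.asIdeal, y ^ 2 = (fbar f v).discr) then (X - 1) * (X + 1) ^ 2
          else X ^ 3 + X ^ 2 + X + 1 : ℤ[X]).map (Int.castRingHom ℂ) := by
  refine ⟨isFiniteOrder_eps _ _ _, ?_⟩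
  filter_upwards [(finite_badSet (isSepQuartic_of_hyp hdeg hsep) (twelve_dvd_card_G_of_hyp hdeg hsep hgal hreal)
    (leadingCoeff_ne_zero_of_hyp hdeg)).compl_mem_cofinite] with v hv
  exact finprod_eq_table_of_not_mem_badSet _ _ _ hv

end Summit.Langlands.Langlands.Theorems.ResidualAutomorphyEven
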